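import Mathlib
import Summits.KontsevichZagierPeriods.Zeta5Search.LevelClassDigits
import Summits.KontsevichZagierPeriods.Zeta5Search.RecordCellEzProof
import Summits.KontsevichZagierPeriods.Zeta5Search.ConstantTermFloorWindow
import HarnessLib

/-!
# ζ(5) search — CELL KIT, part 1: level classes, conjugation, types under the shift (generic in `b`)

Cell `pub-zeta5` (HONEST FRAMING: systematic search; no irrationality claim unless certified), P1 prover seat generation 7.
Generic bookkeeping for the cell proofs of gen-2 g9's first-digit atlas (`RecordAtlasCells`, `RayAtlasCellsRows`, `RayAtlasCellsX`):
for `x < p` with `x + Lp ≤ b₀ < x + (L+1)p` the class of `x` is the LEVEL CLASS `{x + kp : k ≤ L}` (`LevelClassDigits`), so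
* the class exponent is the level sum plus the odd-centre term (`classExp_eq_levelSum`), and `CentreIn` means `2x + kp = b₀` for some
  `k ≤ L` (`centreIn_iff_level`);
* the conjugate residue `x̄ = conjClass b p x = b₀ − (x + Lp)` carries the REVERSED type (`netExp_conj_level`), hence
  `ŵ_x̄ = ŵ(T^rev)`, `v̂_x̄ = v̂(T^rev)` (`wHat_conj_level`, `vHat_conj_level`);
* under the shift `b ↦ b + e_j` a class through a moved point `b_j`, `b₀ − b_j` gains at least one unit of class exponent
  (`classExp_shift_ge_succ`), and a class avoiding both keeps its type (`netExp_shift_of_unhit`).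
Valuation-free combinatorics and the type invariance of P1 g6; nothing about irrationality.
-/

noncomputable section

open Finset

namespace Summit.KontsevichZagierPeriods.Zeta5Search.CellKit

open Summit.KontsevichZagierPeriods.Zeta5Search.DualSeries (InBox)
open Summit.KontsevichZagierPeriods.Zeta5Search.CasoratianValuation (InPolytope shift)
open Summit.KontsevichZagierPeriods.Zeta5Search.ClusterValuation (netExp classSet CentreIn classExp conjClass
  classSet_shift centreIn_shift classExp_shift_ge le_of_mem_classSet conjClass_lt conjClass_conjClass classExp_conj centreIn_conj_iff)
open Summit.KontsevichZagierPeriods.Zeta5Search.BigPrime (shift_zero)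
open Summit.KontsevichZagierPeriods.Zeta5Search.CellA (wHat vHat netExp_shift_eq)
open Summit.KontsevichZagierPeriods.Zeta5Search.LevelClass

variable {p : ℕ} [hp : Fact p.Prime]

/-! ### §1 Level classes: class exponent, centre, conjugate -/

section Level

variable (b : ℕ → ℤ) {x L : ℕ} (hx : x < p) (hL : x + L * p ≤ (b 0).toNat) (hL' : (b 0).toNat < x + L * p + p)

include hx hL hL' in
/-- **The class exponent of a level class**: the level sum of the net exponents plus the odd-centre term. -/
theorem classExp_eq_levelSum :
    classExp b p x = (∑ k ∈ range (L + 1), netExp b (x + k * p)) +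
      (if ¬ (2 : ℤ) ∣ b 0 ∧ CentreIn b p x then 1 else 0) := by
  unfold classExp
  rw [classSet_level b hx hL hL', sum_image (fun a _ c _ h => level_injective hp.out.pos x h)]

include hx hL hL' in
/-- **The centre condition of a level class**: `p ∣ 2x − b₀` iff `2x + kp = b₀` for some `k ≤ L` (for `0 ≤ b₀`). -/
theorem centreIn_iff_level (h0 : 0 ≤ b 0) : CentreIn b p x ↔ ∃ k, k ≤ L ∧ 2 * x + k * p = (b 0).toNat := by
  have hb0 : b 0 = (((b 0).toNat : ℕ) : ℤ) := (Int.toNat_of_nonneg h0).symm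
  set N := (b 0).toNat with hN
  unfold CentreIn
  rw [hb0]
  constructor
  · rintro ⟨c, hc⟩
    have hp0 : (0 : ℤ) < p := by exact_mod_cast hp.out.pos
    -- `2x − N = p c`, so `k = −c ≥ 0`
    have hc0 : c ≤ 0 := by
      by_contra hpos
      push Not at hpos
      have : (p : ℤ) * 1 ≤ (p : ℤ) * c := mul_le_mul_of_nonneg_left (by omega) hp0.le
      omega
    have hcL : -c ≤ (L : ℤ) := by
      by_contra hlt
      push Not at hlt
      have : (p : ℤ) * ((L : ℤ) + 1) ≤ (p : ℤ) * (-c) := mul_le_mul_of_nonneg_left (by omega) hp0.le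
      have h2 : (((b 0).toNat : ℕ) : ℤ) < ((x + L * p + p : ℕ) : ℤ) := by exact_mod_cast hL'
      push_cast at h2
      nlinarith
    refine ⟨(-c).toNat, by omega, ?_⟩
    have hk : (((-c).toNat : ℕ) : ℤ) = -c := Int.toNat_of_nonneg (by omega)
    have e : ((2 * x + (-c).toNat * p : ℕ) : ℤ) = ((N : ℕ) : ℤ) := by push_cast; rw [hk]; linarith
    exact_mod_cast e
  · rintro ⟨k, -, hk⟩
    refine ⟨-(k : ℤ), ?_⟩
    have e : ((2 * x + k * p : ℕ) : ℤ) = ((N : ℕ) : ℤ) := by exact_mod_cast hk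
    push_cast at e
    linarith

include hL hL' in
omit hp in
/-- **The conjugate residue of a level class is `b₀ − (x + Lp)`.** -/
theorem conjClass_eq_level : conjClass b p x = (b 0).toNat - (x + L * p) := by
  unfold conjClass
  set N := (b 0).toNat with hN
  have h1 : N - x = (N - (x + L * p)) + L * p := by omega
  rw [h1, Nat.add_mul_mod_self_right, Nat.mod_eq_of_lt (by omega)]

include hx hL hL' in
omit hp in
/-- The conjugate residue is again a level class with the same `L`. -/
theorem conj_level : conjClass b p x < p ∧ conjClass b p x + L * p ≤ (b 0).toNat ∧
    (b 0).toNat < conjClass b p x + L * p + p := by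
  rw [conjClass_eq_level b hL hL']; omega

include hL hL' in
omit hp in
/-- **The conjugate class carries the reversed type**: `netExp b (x̄ + kp) = netExp b (x + (L−k)p)` for `k ≤ L` (`0 ≤ b₀`). -/
theorem netExp_conj_level (h0 : 0 ≤ b 0) {k : ℕ} (hk : k ≤ L) :
    netExp b (conjClass b p x + k * p) = netExp b (x + (L - k) * p) := by
  rw [conjClass_eq_level b hL hL']
  have hle : x + (L - k) * p ≤ (b 0).toNat := by
    have : (L - k) * p ≤ L * p := Nat.mul_le_mul_right p (Nat.sub_le L k); omega
  have e : (b 0).toNat - (x + L * p) + k * p = (b 0).toNat - (x + (L - k) * p) := by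
    have h1 : (L - k) * p + k * p = L * p := by rw [← Nat.add_mul, Nat.sub_add_cancel hk]
    omega
  rw [e, ClusterValuation.netExp_reflect b h0 hle]

include hx hL hL' in
/-- **`ŵ` of the conjugate class is `ŵ` of the reversed type.** -/
theorem wHat_conj_level (hb : InPolytope b) (e : ℕ → ℤ) (he : ∀ k ≤ L, netExp b (x + k * p) = e k)
    (hc : ¬ CentreIn b p x) : wHat b p (conjClass b p x) = typeW L (fun k => e (L - k)) := by
  have h0 : 0 ≤ b 0 := hb.1.1
  obtain ⟨hx', hM, hM'⟩ := conj_level b hx hL hL'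
  have hc' : ¬ CentreIn b p (conjClass b p x) := fun h => hc ((centreIn_conj_iff b h0 (by omega)).1 h)
  refine wHat_level b hx' hM hM' _ (fun k hk => ?_) hc'
  rw [netExp_conj_level b hL hL' h0 hk, he (L - k) (Nat.sub_le L k)]

include hx hL hL' in
/-- **`v̂` of the conjugate class is `v̂` of the reversed type.** -/
theorem vHat_conj_level (hb : InPolytope b) (e : ℕ → ℤ) (he : ∀ k ≤ L, netExp b (x + k * p) = e k)
    (hc : ¬ CentreIn b p x) : vHat b p (conjClass b p x) = typeV L (fun k => e (L - k)) := by
  have h0 : 0 ≤ b 0 := hb.1.1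
  obtain ⟨hx', hM, hM'⟩ := conj_level b hx hL hL'
  have hc' : ¬ CentreIn b p (conjClass b p x) := fun h => hc ((centreIn_conj_iff b h0 (by omega)).1 h)
  refine vHat_level b hx' hM hM' _ (fun k hk => ?_) hc'
  rw [netExp_conj_level b hL hL' h0 hk, he (L - k) (Nat.sub_le L k)]

include hx hL hL' in
/-- **Palindromic types**: if `e_k = e_{L−k}` then `ŵ_x̄ = ŵ_x` and `v̂_x̄ = v̂_x`. -/
theorem hat_conj_of_pal (hb : InPolytope b) (e : ℕ → ℤ) (he : ∀ k ≤ L, netExp b (x + k * p) = e k)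
    (hpal : ∀ k ≤ L, e (L - k) = e k) (hc : ¬ CentreIn b p x) :
    wHat b p (conjClass b p x) = wHat b p x ∧ vHat b p (conjClass b p x) = vHat b p x := by
  rw [wHat_conj_level b hx hL hL' hb e he hc, vHat_conj_level b hx hL hL' hb e he hc, wHat_level b hx hL hL' e he hc,
    vHat_level b hx hL hL' e he hc, typeW_congr (fun k hk => hpal k hk), typeV_congr (fun k hk => hpal k hk)]
  exact ⟨rfl, rfl⟩

include hx hL hL' in
/-- A level class of negative class exponent and without the centre has a pole among its points. -/
theorem exists_pole_level (hc : ¬ CentreIn b p x) (hneg : classExp b p x < 0) :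
    ∃ i₀, i₀ ≤ L ∧ netExp b (x + i₀ * p) < 0 := by
  by_contra hall
  push Not at hall
  have hsum : 0 ≤ ∑ k ∈ range (L + 1), netExp b (x + k * p) :=
    sum_nonneg fun k hk => hall k (by have := mem_range.1 hk; omega)
  rw [classExp_eq_levelSum b hx hL hL', if_neg (fun h => hc h.2), add_zero] at hneg
  exact absurd hneg (not_lt.2 hsum)

end Level

/-! ### §2 The shift `b ↦ b + e_j`: hit classes gain, unhit classes keep their type -/

section Shift

variable (b : ℕ → ℤ) (hb : InPolytope b) {j : ℕ} (hj1 : 1 ≤ j) (hj7 : j ≤ 7) (hb' : InPolytope (shift b j))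

include hj1 hj7 hb' in
/-- `2 b_j ≤ b₀` when both `b` and `b + e_j` lie in the polytope. -/
theorem two_mul_le_of_shift : 2 * b j ≤ b 0 := by
  have h := hb'.2.1 (j - 1) (mem_range.2 (by omega))
  rw [show j - 1 + 1 = j by omega, shift_zero b hj1] at h
  simp [shift] at h
  linarith

include hb hj1 hj7 hb' in
/-- **Exact class exponent under the shift**: `E_x(b + e_j) = E_x(b) + #{moved points b_j, b₀ − b_j in the class}`. -/
theorem classExp_shift_eq (p x : ℕ) :
    classExp (shift b j) p x = classExp b p x +
      ∑ s ∈ classSet b p x, (if s = (b j).toNat ∨ s = (b 0).toNat - (b j).toNat then (1 : ℤ) else 0) := by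
  have h2 := two_mul_le_of_shift b hj1 hj7 hb'
  have hcen : (if ¬ (2 : ℤ) ∣ shift b j 0 ∧ CentreIn (shift b j) p x then (1 : ℤ) else 0) =
      (if ¬ (2 : ℤ) ∣ b 0 ∧ CentreIn b p x then (1 : ℤ) else 0) := by
    rw [shift_zero _ hj1]
    simp only [centreIn_shift b hj1]
  unfold classExp
  rw [classSet_shift b hj1, hcen, sum_congr rfl (fun s _ => netExp_shift_eq b hb.1 hj1 hj7 h2 s), sum_add_distrib]
  ring

include hb hj1 hj7 hb' in
/-- **A class through a moved point gains at least one unit of class exponent under the shift.** -/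
theorem classExp_shift_ge_succ {p x : ℕ}
    (hmem : (b j).toNat ∈ classSet b p x ∨ (b 0).toNat - (b j).toNat ∈ classSet b p x) :
    classExp b p x + 1 ≤ classExp (shift b j) p x := by
  rw [classExp_shift_eq b hb hj1 hj7 hb' p x]
  have hone : (1 : ℤ) ≤ ∑ s ∈ classSet b p x,
      (if s = (b j).toNat ∨ s = (b 0).toNat - (b j).toNat then (1 : ℤ) else 0) := by
    rcases hmem with h | h
    · exact le_trans (by rw [if_pos (Or.inl rfl)]) (single_le_sum (fun i _ => by positivity) h)
    · exact le_trans (by rw [if_pos (Or.inr rfl)]) (single_le_sum (fun i _ => by positivity) h)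
  linarith

include hb hj1 hj7 hb' in
/-- **An unhit class keeps its net exponents under the shift.** -/
theorem netExp_shift_of_unhit {p x : ℕ} (h1 : (b j).toNat ∉ classSet b p x)
    (h2 : (b 0).toNat - (b j).toNat ∉ classSet b p x) {s : ℕ} (hs : s ∈ classSet b p x) :
    netExp (shift b j) s = netExp b s := by
  rw [netExp_shift_eq b hb.1 hj1 hj7 (two_mul_le_of_shift b hj1 hj7 hb') s, if_neg, add_zero]
  rintro (rfl | rfl)
  · exact h1 hs
  · exact h2 hs

include hb hj1 hj7 hb' in
/-- If the class exponent does not move under the shift, the class is unhit. -/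
theorem unhit_of_classExp_eq {p x : ℕ} (heq : classExp (shift b j) p x = classExp b p x) :
    (b j).toNat ∉ classSet b p x ∧ (b 0).toNat - (b j).toNat ∉ classSet b p x := by
  by_contra h
  rw [not_and_or, not_not, not_not] at h
  have := classExp_shift_ge_succ b hb hj1 hj7 hb' (p := p) (x := x) h
  omega

end Shift

end Summit.KontsevichZagierPeriods.Zeta5Search.CellKit

end
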